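import Summits.Parity.BatemanHorn.Theorems.RoughValueTransportBalancedSemiprimeLayerSplit
import HarnessLib

/-!
# r1 strategist hand-over: the 4-way degree split `{1, 2, 3, ≥ 4}` of `BalancedSemiprimeLayer`, glue PROVED

Children texts (route-file vocabulary, each the unfolded `CoordLayerThin` of
`Theorems/RoughValueTransportBalancedSemiprimeLayerSplit.lean` with the degree condition changed):
`LayerLinear` (deg = 1, PROVED `Split.layerLinear_unfolded`), `LayerQuadratic` (deg = 2, PROVED
`Split.layerQuadratic_unfolded`), `LayerCubic` (deg = 3, OPEN), `LayerQuarticUp` (deg ≥ 4, OPEN).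
`stub_degreeSplit4 : LayerLinear → LayerQuadratic → LayerCubic → LayerQuarticUp → ⟨crux body⟩` is the
glue (trichotomy `3 = deg ∨ 4 ≤ deg` + the landed `stub_degreeSplit`/`stub_transfer`).
Why one might prefer it to the 3-way split: the cubic slice is the only one where a per-frequency
Fourier road exists even in principle (needed saving `M^{1/3+}` at `M = x^{3/2}`, below square root),
while for `d ≥ 4` the needed saving is at or beyond square root per frequency (r1 census §Transfer),
so the two leaves have different literatures and different (absent) tools.
-/

namespace Summit.Parity.BatemanHorn.Cruxes.BalancedSemiprimeLayer.StrategistR1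

open Summit.Parity.BatemanHorn.Cruxes.BalancedSemiprimeLayer.SmoothModulusTwistedHooley (stub_degreeSplit)

/-- `LayerCubic`: thin layer for every coordinate of degree exactly `3`. [folklore] -/
def LayerCubic : Prop :=
  ∀ (k : ℕ) (f : Fin k → Polynomial ℤ), Literature.NumberTheory.Sieve.IsBatemanHornSystem f →
      ∀ i : Fin k, (f i).natDegree = 3 → ∀ ε : ℝ, 0 < ε → ∃ δ : ℝ, 0 < δ ∧ δ ≤ 1 / 4 ∧
        ∀ᶠ x : ℕ in Filter.atTop,
          (((Finset.Icc 1 x).filter (fun n : ℕ => (∀ j, 0 < (f j).eval (n : ℤ) ∧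
              ∀ p ∈ Finset.range ⌈(x : ℝ) ^ (((f j).natDegree : ℝ) * (1 - δ) / 2)⌉₊,
                p.Prime → ¬ ((p : ℤ) ∣ (f j).eval (n : ℤ))) ∧
              ¬ ((f i).eval (n : ℤ)).toNat.Prime)).card : ℝ) ≤ ε * (x : ℝ) / Real.log x ^ k

/-- `LayerQuarticUp`: thin layer for every coordinate of degree `≥ 4`. [folklore] -/
def LayerQuarticUp : Prop :=
  ∀ (k : ℕ) (f : Fin k → Polynomial ℤ), Literature.NumberTheory.Sieve.IsBatemanHornSystem f →
      ∀ i : Fin k, 4 ≤ (f i).natDegree → ∀ ε : ℝ, 0 < ε → ∃ δ : ℝ, 0 < δ ∧ δ ≤ 1 / 4 ∧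
        ∀ᶠ x : ℕ in Filter.atTop,
          (((Finset.Icc 1 x).filter (fun n : ℕ => (∀ j, 0 < (f j).eval (n : ℤ) ∧
              ∀ p ∈ Finset.range ⌈(x : ℝ) ^ (((f j).natDegree : ℝ) * (1 - δ) / 2)⌉₊,
                p.Prime → ¬ ((p : ℤ) ∣ (f j).eval (n : ℤ))) ∧
              ¬ ((f i).eval (n : ℤ)).toNat.Prime)).card : ℝ) ≤ ε * (x : ℝ) / Real.log x ^ k

/-- `LayerHigher` (deg ≥ 3, the 3-way split's leaf) from the two finer leaves. [folklore] -/
theorem layerHigher_of_cubic_of_quarticUp (h3 : LayerCubic) (h4 : LayerQuarticUp) :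
    ∀ (k : ℕ) (f : Fin k → Polynomial ℤ), Literature.NumberTheory.Sieve.IsBatemanHornSystem f →
      ∀ i : Fin k, 3 ≤ (f i).natDegree → ∀ ε : ℝ, 0 < ε → ∃ δ : ℝ, 0 < δ ∧ δ ≤ 1 / 4 ∧
        ∀ᶠ x : ℕ in Filter.atTop,
          (((Finset.Icc 1 x).filter (fun n : ℕ => (∀ j, 0 < (f j).eval (n : ℤ) ∧
              ∀ p ∈ Finset.range ⌈(x : ℝ) ^ (((f j).natDegree : ℝ) * (1 - δ) / 2)⌉₊,
                p.Prime → ¬ ((p : ℤ) ∣ (f j).eval (n : ℤ))) ∧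
              ¬ ((f i).eval (n : ℤ)).toNat.Prime)).card : ℝ) ≤ ε * (x : ℝ) / Real.log x ^ k := by
  intro k f hf i hi
  rcases Nat.lt_or_ge (f i).natDegree 4 with hlt | hge
  · exact h3 k f hf i (by omega)
  · exact h4 k f hf i hge

/-- **stub_degreeSplit4** — glue of the 4-way split, PROVED: `LayerLinear → LayerQuadratic → LayerCubic →
LayerQuarticUp → ⟨crux body verbatim⟩` (the first two hypotheses are the landed theorems
`Split.layerLinear_unfolded`, `Split.layerQuadratic_unfolded` and are passed through to the landed
3-way glue `stub_degreeSplit`). [folklore] -/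
theorem stub_degreeSplit4 :
    (∀ (k : ℕ) (f : Fin k → Polynomial ℤ), Literature.NumberTheory.Sieve.IsBatemanHornSystem f →
      ∀ i : Fin k, (f i).natDegree = 1 → ∀ ε : ℝ, 0 < ε → ∃ δ : ℝ, 0 < δ ∧ δ ≤ 1 / 4 ∧
        ∀ᶠ x : ℕ in Filter.atTop,
          (((Finset.Icc 1 x).filter (fun n : ℕ => (∀ j, 0 < (f j).eval (n : ℤ) ∧
              ∀ p ∈ Finset.range ⌈(x : ℝ) ^ (((f j).natDegree : ℝ) * (1 - δ) / 2)⌉₊,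
                p.Prime → ¬ ((p : ℤ) ∣ (f j).eval (n : ℤ))) ∧
              ¬ ((f i).eval (n : ℤ)).toNat.Prime)).card : ℝ) ≤ ε * (x : ℝ) / Real.log x ^ k) →
    (∀ (k : ℕ) (f : Fin k → Polynomial ℤ), Literature.NumberTheory.Sieve.IsBatemanHornSystem f →
      ∀ i : Fin k, (f i).natDegree = 2 → ∀ ε : ℝ, 0 < ε → ∃ δ : ℝ, 0 < δ ∧ δ ≤ 1 / 4 ∧
        ∀ᶠ x : ℕ in Filter.atTop,
          (((Finset.Icc 1 x).filter (fun n : ℕ => (∀ j, 0 < (f j).eval (n : ℤ) ∧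
              ∀ p ∈ Finset.range ⌈(x : ℝ) ^ (((f j).natDegree : ℝ) * (1 - δ) / 2)⌉₊,
                p.Prime → ¬ ((p : ℤ) ∣ (f j).eval (n : ℤ))) ∧
              ¬ ((f i).eval (n : ℤ)).toNat.Prime)).card : ℝ) ≤ ε * (x : ℝ) / Real.log x ^ k) →
    LayerCubic → LayerQuarticUp →
      ∀ (k : ℕ) (f : Fin k → Polynomial ℤ), Literature.NumberTheory.Sieve.IsBatemanHornSystem f →
        ∀ ε : ℝ, 0 < ε → ∃ δ : ℝ, 0 < δ ∧ δ ≤ 1 / 4 ∧ ∀ᶠ x : ℕ in Filter.atTop,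
          (((Finset.Icc 1 x).filter (fun n : ℕ => ∀ i, 0 < (f i).eval (n : ℤ) ∧
              ∀ p ∈ Finset.range ⌈(x : ℝ) ^ (((f i).natDegree : ℝ) * (1 - δ) / 2)⌉₊,
                p.Prime → ¬ ((p : ℤ) ∣ (f i).eval (n : ℤ)))).card : ℝ) ≤
            (Literature.NumberTheory.Sieve.polyPrimeCount f x : ℝ) + ε * (x : ℝ) / Real.log x ^ k :=
  fun h1 h2 h3 h4 => stub_degreeSplit h1 h2 (layerHigher_of_cubic_of_quarticUp h3 h4)

/-- By-name check: the 4-way glue's conclusion IS the route decl. [folklore] -/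
theorem crux_of_split4
    (h1 : ∀ (k : ℕ) (f : Fin k → Polynomial ℤ), Literature.NumberTheory.Sieve.IsBatemanHornSystem f →
      ∀ i : Fin k, (f i).natDegree = 1 → ∀ ε : ℝ, 0 < ε → ∃ δ : ℝ, 0 < δ ∧ δ ≤ 1 / 4 ∧
        ∀ᶠ x : ℕ in Filter.atTop,
          (((Finset.Icc 1 x).filter (fun n : ℕ => (∀ j, 0 < (f j).eval (n : ℤ) ∧
              ∀ p ∈ Finset.range ⌈(x : ℝ) ^ (((f j).natDegree : ℝ) * (1 - δ) / 2)⌉₊,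
                p.Prime → ¬ ((p : ℤ) ∣ (f j).eval (n : ℤ))) ∧
              ¬ ((f i).eval (n : ℤ)).toNat.Prime)).card : ℝ) ≤ ε * (x : ℝ) / Real.log x ^ k)
    (h2 : ∀ (k : ℕ) (f : Fin k → Polynomial ℤ), Literature.NumberTheory.Sieve.IsBatemanHornSystem f →
      ∀ i : Fin k, (f i).natDegree = 2 → ∀ ε : ℝ, 0 < ε → ∃ δ : ℝ, 0 < δ ∧ δ ≤ 1 / 4 ∧
        ∀ᶠ x : ℕ in Filter.atTop,
          (((Finset.Icc 1 x).filter (fun n : ℕ => (∀ j, 0 < (f j).eval (n : ℤ) ∧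
              ∀ p ∈ Finset.range ⌈(x : ℝ) ^ (((f j).natDegree : ℝ) * (1 - δ) / 2)⌉₊,
                p.Prime → ¬ ((p : ℤ) ∣ (f j).eval (n : ℤ))) ∧
              ¬ ((f i).eval (n : ℤ)).toNat.Prime)).card : ℝ) ≤ ε * (x : ℝ) / Real.log x ^ k)
    (h3 : LayerCubic) (h4 : LayerQuarticUp) :
    Summit.Parity.BatemanHorn.Theses.RoughValueTransport.BalancedSemiprimeLayer :=
  stub_degreeSplit4 h1 h2 h3 h4

end Summit.Parity.BatemanHorn.Cruxes.BalancedSemiprimeLayer.StrategistR1
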